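import Mathlib
import Literature.NumberTheory.EllipticCurves.PAdicOneVariableGaussSum

set_option linter.dupNamespace false

/-!
# STUB-IDEAS k2 (gen 37) — «(21)₀ IS ALREADY IN THE TREE AT p = 2»: the table factor of the atom
# (KLF-COSET)₂ (STUB-PLAN v7.0 HARDEST (b) R197a″ (i), typing B, factor 1 of 3) is the tree theorem
# `mul_integral_mulChar_invAmice₁_eq_gaussSum_mul` / `BoundedDistribution.mul_sum_mulChar_mul_μ_eq_gaussSum_mul`
# (de Shalit II.4.8 (19)–(21) on `ℤ_pˣ`, p-parity-free) under a five-line typed dictionary; here it is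
# SPECIALISED IN KERNEL at `p = 2`, level `8 = 2^{2+1}`, consumed type `θ = χ₈` (§2c), with its three
# `p = 2`-sensitive bridges typed and checked at the consumed types: (B1) the Gauss factor
# `Σ_b θ(b)ζ^b = gaussSum θ (zmodChar ζ)` EVALUATED by Mathlib (`= 2√u₀`, the quadratic resolvent — so
# de Shalit's `τ(θ̄)` cancels the `g`-currency denominator EXACTLY, R200′(b′)(c), §2–§3); (B2) the
# (7′)-`½`-correction is INVISIBLE on the coset (antiperiodic weight × periodic correction, §5); (B3) the
# unit-indexed sum is the `Gal(F_e/F)`-indexed sum along `κ̄` with non-units silent ((22)₀, §6).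
# BSD is NOT proved by any of this.

Stub of record (NOT re-typed here): `stub_heegnerIndexLowerAtTwo` (ACTIVE skeleton `heegner_index_two`,
sha16 `f2bd84c029a8a938`), crux `PrintCf2.SplitBadTwoLowerHalfOfFacts` = stmt-BirchSwinnertonDyer-27851.
**BSD is NOT proved by any of this; neither is the crux, the stub, node (2)₂, R197a″ or the atom.**  This
file is commutative algebra + three finite evaluations + one specialisation of a tree theorem (0 `sorry`,
no `instance`, no `notation`, no `def … : Prop`): it kernel-checks the 2-adic bookkeeping of the
`(R2) ⊕ resolvent` seam of `c(key) = ∫ρ_v dC_v` (row 84's `𝒜_v ∗ katz = C_v ∗ col`) on the ONE coset that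
row 107 (k1-g35, B64 CONSUMER-TYPE FIRST) says the consumer needs, and instantiates the TREE's one-variable
engine there.  STUB-PLAN v7.0: HARDEST NOW (b) = **R197a″ «(KLF-COSET)₂»** (typing A cite-grade | typing B
= `charSum_unitMeasure_eq_log_coleman_at_primitive` from tree `mul_sum_mulChar_mul_μ_eq_gaussSum_mul` +
`exists_evalAt_cohPt_eq` + a split-`𝔮` lemma, row 107) ⊕ R200′(b′) (column home / pairing for `col` at
level `n(key)`); OPEN CREDIT per asks (n′): the atom, H-FI, R216′, R200′(b′), (3)₂.  NODE OF THIS FILE =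
typing B, FACTOR 1 (the table identity) — kernel-specialised, not planned — plus the R200′(b′)(c)
bookkeeping that factor 1's evaluated Gauss sum forces.  K49: nothing of the coset cut (`E_θ`,
`eval_cosetSum`, the value forms) is re-derived — the coset is taken as GIVEN.  The unit statement
`τ_dS·2√u ∈ 𝒪̂ˣ` is k3-g37's («GAUSS = TWIST», filed 19:34Z while this was written); §3 here only records
the sharper `u₀`-oriented form `τ_dS(θ̄)·2√u₀ = 1` as factor 1's by-product, no separate credit sought.

## The dictionary (print ↦ Mathlib ↦ tree / route), level `n = e = n(key) ∈ {2, 3}` (row 95), inertia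
## type `θ = χ_{d,v}|_{I_v} ∈ {χ₄ (u = −1, 3), χ₈ (u = 2, −6), χ₈′ = χ₄χ₈ (u = −2, 6)}`, `w_𝔣 = 1`

* de Shalit II.5.2 (3) [p. 79 L19–23; `e_n(𝔞)`, `σ_𝔮`: p. 80 L1–2], on the coset (Euler factor
  `1 − χ⁻¹(𝔭)/p = 1` for `𝔭 ∣ 𝔣_χ`, row 84 §2):
  `∫_𝒢 χ⁻¹ dμ_𝔞 = τ(χ⁻¹) · Σ_{𝔠 ∈ Gal(F_e/K)} χ(𝔠) · log σ_𝔠(e_e(𝔞))^{σ_𝔮}`   — THE ATOM's print line.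
* II.4.8 (19) [p. 61 L1–4]: `τ(χ⁻¹) = 2^{−e}·Σ_{γ ∈ Gal(F_e/F)} θ(γ) ς_e^{−κ(γ)} = 2^{−e}·ḡ(θ)`,
  `ḡ(θ) := g(θ, ψ̄) = θ(−1)·g(θ, ψ)` (Mathlib `gaussSum_mulShift`, `a = −1`; here `gaussX_inv`),
  `g(θ, ψ) = Σ_b θ(b) ζ^b = gaussSum θ (zmodChar ζ)` (`sum_mulChar_mul_pow_eq_gaussSum`) = the Gauss
  factor of the tree theorem `BoundedDistribution.mul_sum_mulChar_mul_μ_eq_gaussSum_mul` (II.4.8 (21) on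
  `ℤ₂ˣ`, IN TREE — cited and SPECIALISED (`tree_table_resolvent_form`, `tree_table_condEight_chi8`),
  not re-derived).  B45: the `2^{−e}` is carried.
* EVALUATION (Mathlib match, `gaussSum_chi4_eq` / `gaussSum_chi8_eq` / `gaussSum_chi8'_eq`):
  `g(χ₄) = i − i³`, `g(χ₈) = ζ − ζ³ − ζ⁵ + ζ⁷`, `g(χ₈′) = ζ + ζ³ − ζ⁵ − ζ⁷` (`ζ = ζ₈`, `i = ζ²`).
* Inertia sub-sum = the `col` COLUMN HOME (R200′(b′)): `Gal(F_e/F) = I_v ≅ (ℤ/2^e)ˣ` acts on the units of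
  the level-`e` layer `M = F_e`; `L := M^{ker θ}` is QUADRATIC over `F`, and
  `Σ_{γ ∈ Gal(M/F)} θ(γ)·log(γx) = log((1 − σ_L)·N_{M/L} x)` (`pair_charSum_log` (`e = 2`, `M = L`),
  `klein_charSum_log` (`e = 3`, Klein four, `ker θ = {1, k}`)); so
  `Σ_{𝔠∈Gal(F_e/K)} χ(𝔠) log σ_𝔠 e = Σ_{c̄ ∈ Gal(F/K)} χ(𝔠)·log((1−σ_L) N_{M/L} σ_𝔠 e)`: the type-`θ`
  entries of `col` live on `(1−σ_L)·U¹(L)` — locally at `v` (m ≥ 1) the route's own receptacle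
  `D_m = (1−σ)U¹(L_m)`, `L_m = F_m(√u)` (rows 88–103; B61: comparison BY `1−σ`, integral).
* `g`-currency of record (row 101 / R206): `g_{u₀} := log/(2√u₀)`, `L = Lg_u = (2w)•g`; the quadratic
  RESOLVENT of `L/F` is `r := (1+√u₀) − σ_L(1+√u₀) = 2√u₀`, so `log((1−σ_L)y) = r · g_{u₀}((1−σ_L)y)`.
* ORIENTATION (the one convention introduced): `√u₀ := g(θ, ψ)/2`, `u₀ = θ(−1)·2^{e−2} ∈ {−1, 2, −2}`
  (`s4 = ζ²`, `s8 = ζ − ζ³`, `s8' = ζ + ζ³`; `sX_sq`) — then `g(θ, ψ) = r` ON THE NOSE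
  (`gaussX_eq_two_mul`): THE GAUSS SUM IS THE RESOLVENT.
* SEAM (`seam_constant_one`, instances `_condFour/_condEight/_condEight'`): `2^e·∫ = ḡ·S`, `ḡ = θ(−1)g`,
  `S = r·gv`, `g = r`, `g² = θ(−1)2^e`, `θ(−1)² = 1` ⟹ `∫ = gv`, i.e.
  `∫_𝒢 χ⁻¹ dμ_𝔞 = Σ_{c̄ ∈ Gal(F/K)} χ(𝔠) · g_{u₀}((1−σ_L) N_{M/L} σ_𝔠 e_e(𝔞))^{σ_𝔮}` — constant EXACTLY
  `1` (opposite orientation: exactly `θ(−1)`, `seam_constant_sign`; either way a SIGN, B44 unit grade).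
  R200′(c) as an identity: `τ_dS(θ̄)·r = 1` (`tau_mul_resolvent`): the docket halves `−n(key)/2` ((R2),
  `v₂ τ_dS`) and `+n(key)/2 = v₂ r = 1 + v₂√u₀` cancel with NO residual unit.  R200′(b′)'s clause
  «which normalisation of the log data absorbs `2^{−n(key)}`»: the `g`-normalisation — division by the
  resolvent `r = 2√u₀` of the column's home layer — absorbs the whole `τ_dS·2^e = ḡ`, nothing else does.
  In `L`-currency the coset value is `(2w)⁻¹·Σ χ(𝔠) L(…)` (`L_currency`; `2w` is R206's, named, not netted).

## Typing-B dictionary for FACTOR 1 of the atom (print ↦ tree), one `𝔠`-coset at a time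

* `G = Gal(F_∞/F) —κ→ ℤ₂ˣ ⊂ ℤ₂` (I.3.3 (9), I.3.4 (10)): de Shalit's `μ⁰_{σ_𝔠β(𝔞)}|_G` ↦ tree
  `invAmice₁ 2 P_𝔠 hC` with `P_𝔠 := ã_{σ_𝔠β(𝔞)} = log g̃_{σ_𝔠β(𝔞)}∘θ ∈ 𝒪̂[[S]]` (I.3.3 (8): `P_μ = ã_β`;
  bounded coefficients = the hypothesis `hC`, `C = 1`) — TYPER RESIDUE (T1): this identification IS the
  definition of `μ_β`, to be stated on the route's frame (row 84 / R216′), not proved here.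
* `χ` with `χ|_{Gal(F_e/F)} = θ`, «`e` the exact power of `𝔭` in `𝔣_χ`» ↦ `θ.ringHomComp (Int.castRingHom 𝕜)
  : DirichletCharacter 𝕜 (2^e)` + `IsPrimitive` (hypothesis `hχ`; dischargeable: `χ₈(5) = −1`, `χ₄(3) = −1`).
* `ς_e` ↦ `ζ`, `IsPrimitiveRoot ζ (2^e)`; `τ(χ) = 2^{−e}Σ_γ χ(γ)ς_e^{−κγ} = 2^{−e}·θ(−1)·g(θ, ζ)` ↦
  `(2^e)⁻¹ · Σ_b θ(b)ζ^{b}` up to `θ(−1)` (`gaussX_inv`), `= 2^{−e}·θ(−1)·2√u₀` (B1).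
* `∫_G χ dμ⁰_{σ_𝔠β}` ↦ `(invAmice₁ 2 P_𝔠 hC).integral (θ ∘ toZModPow e)`;
  `δ_{0,e}(γσ_𝔠β)⁰ = log(g_{σ_𝔠β}∘θ)(ς_e^{κγ} − 1)` (II.4.5(iv), (22)₀) ↦ `Σ' m, coeff m P (ζ^j − 1)^m` at
  `j = κ̄γ` (B3, `sum_mulChar_reindex_galois`), the `½`-normalisation dropping out on the coset (B2,
  `coset_sum_correction_invisible`), non-units `j` silent (`sum_mulChar_mul_eq_sum_units`).
* RESULT (tree, specialised: `tree_amice_condEight_chi8`, `tree_table_condEight_chi8`):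
  `2^e·∫_G χ dμ⁰_{σ_𝔠β} = 2√u₀ · Σ_j θ̄(−j)·P_𝔠(ζ^j − 1)`, i.e. de Shalit's (21)₀ restricted to one coset
  `σ_𝔠G`, with NO stray constant (`τ_dS = 2^{−e}θ(−1)g` matches the tree's `g·θ̄(−1)` on the nose).
* NOT in factor 1 (factors 2, 3 of typing B; row 107): Coleman interpolation `g_{e(𝔞)}(θ(ς_e − 1)) =
  e_e(𝔞)^{σ_𝔮}`-type evaluation (II.4.9(ii); tree `LubinTateColemanInterpolation.exists_evalAt_cohPt_eq`)
  and the split prime `𝔮` (II.4.10 Lemma p. 63: `(𝔮, 𝔣𝔭) = 1`, `N𝔮 ≡ 1 mod 2^e`, `(𝔮, F/K) = (𝔭^e, F/K)`;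
  II.4.11 p. 66 adds `(𝔮, F′_e/K) = (𝔭^e, F′_e/K)` — Chebotarev, p-parity-free); the outer sum over
  `𝔠 ∈ Gal(F/K)` (row 107's glue, R216′).  `p = 2` in print: II.4.12 handles `p = 2, 3` via Prop. II.2.7
  (p. 48 L30); the «extra powers of 2» of II.4.14 (40) (p. 73 REMARK) concern types `(k, j)`, `k ≥ 1`, and
  wash out as `m → ∞` — the `k = 0` KLF line (21)₀/(3) carries none of them.

NOT touched (E1 / B45 / B54 / K39 / K49): docket rows (R1) (value ↔ measure, (36)/(37)), (R3)–(R5); the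
Dirac column `χ⁻¹(𝔮)` / `ρ_v(σ_𝔮)^{∓1}` (a unit); `12·(χ⁻¹(𝔞) − N𝔞)` of II.5.2 (4) (belongs to the
normalised `μ(𝔣)`, not to `μ_𝔞`); `w_𝔣`, `Ω_v`, Pal's model digit; the UNRAMIFIED outer sum over
`Gal(F/K)` and the passage finite-order `χ` ↦ `ρ_v` (row 107's coset glue, PROVED there); H-FI; the
atom's other two factors (Coleman evaluation `exists_evalAt_cohPt_eq`, split `𝔮`).  NO net digit of
`v₂ Q(W)` is asserted.  Located wrinkle: for `u ∈ {3, 6, −6}` the `θ`-quadratic field over `ℚ₂` is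
`ℚ₂(√u₀) ≠ ℚ₂(√u)` at layer `0`; from layer `1` on (`u/u₀ ∈ {1, −3}`, `−3 = (2ζ₃+1)² ∈ (F₁ˣ)²`,
`sqrt_neg_three_of_zeta3`) `F_m(√u₀) = F_m(√u) = L_m` and `g_u = ε⁻¹·g_{u₀}`, `ε ∈ 𝒪ˣ` (`g_currency_rescale`).

References: [deShalit1987] I.3.3–3.6 (5)–(12) pp. 17–19; II.4.8 (19)–(22) p. 61; II.5.2 (2)–(4)
pp. 79–80.  Tree: `Literature/NumberTheory/EllipticCurves/PAdicOneVariableGaussSum.lean` (imported;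
`BoundedDistribution.mul_sum_mulChar_mul_μ_eq_gaussSum_mul`), `DeShalit1987/LMeasureExistence.lean`
(«NOT typed: the 𝔭-ramified points and the Gauss sum» — the coset entries).  Mathlib: `gaussSum`,
`gaussSum_mulShift`, `ZMod.χ₄/χ₈/χ₈'`, `AddChar.zmodChar(_apply)`, `IsPrimitiveRoot`.  Crux cards: k3-g29
(row 84), k2-g33 (row 95), k1-g33 (row 101), k1-g35 (row 107), k3-g36 (row 106, R216′).
-/

namespace Summit.BirchSwinnertonDyer.BirchSwinnertonDyer.Cruxes.SplitBadTwoLowerHalfOfFacts.GaussIsResolventK2G37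

/-! ## §1  The `θ`-column home: character sums of conjugate logarithms over `Gal(M/F) ≅ (ℤ/2^e)ˣ`
collapse to `log((1 − σ_L)·N_{M/L} x)` (index-two kernel) -/

section Collapse

variable {Γ : Type*} [Group Γ] {M : Type*} [CommGroup M] [MulDistribMulAction Γ M]
variable {X : Type*} [AddCommGroup X]

/-! A logarithm is any `ℓ : M → X` with `ℓ(xy) = ℓ x + ℓ y` (hypothesis `hℓ`, no new `Prop` def;
[deShalit1987, II.5.2 «"log" denotes any branch of the p-adic logarithm», p. 79]). -/

omit [MulDistribMulAction Γ M] in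
theorem log_one {ℓ : M → X} (hℓ : ∀ x y, ℓ (x * y) = ℓ x + ℓ y) : ℓ 1 = 0 := by
  have h := hℓ 1 1
  rw [one_mul] at h
  exact left_eq_add.mp h

omit [MulDistribMulAction Γ M] in
theorem log_inv {ℓ : M → X} (hℓ : ∀ x y, ℓ (x * y) = ℓ x + ℓ y) (x : M) : ℓ x⁻¹ = -ℓ x := by
  have h := hℓ x x⁻¹
  rw [mul_inv_cancel, log_one hℓ] at h
  exact (neg_eq_of_add_eq_zero_right h.symm).symm

omit [MulDistribMulAction Γ M] in
/-- `ℓ(x / y) = ℓ x − ℓ y`: the `(1 − σ)`-form. [this file] -/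
theorem log_div {ℓ : M → X} (hℓ : ∀ x y, ℓ (x * y) = ℓ x + ℓ y) (x y : M) :
    ℓ (x / y) = ℓ x - ℓ y := by
  rw [div_eq_mul_inv, hℓ, log_inv hℓ, sub_eq_add_neg]

/-- **`e = 2` (`θ = χ₄`, `Gal(M/F) = {1, σ} ≅ (ℤ/4)ˣ`, `M = L = F(√−1)`):**
`Σ_γ θ(γ) ℓ(γβ) = ℓ β − ℓ(σβ) = ℓ((1−σ)β)` with `(1−σ)β := β / σβ`. [this file] -/
theorem pair_charSum_log {ℓ : M → X} (hℓ : ∀ x y, ℓ (x * y) = ℓ x + ℓ y) (σ : Γ) (β : M) :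
    ℓ β - ℓ (σ • β) = ℓ (β / σ • β) :=
  (log_div hℓ β (σ • β)).symm

/-- **`e = 3` (`θ ∈ {χ₈, χ₈′}`, `Gal(M/F) = {1, k, σ, σk} ≅ (ℤ/8)ˣ`, `ker θ = {1, k}`,
`L = M^{⟨k⟩} = F(√u₀)`):** the Klein-four character sum of conjugate logarithms is the logarithm of
`(1 − σ_L)` applied to the NORM `N_{M/L} β = β·kβ`:
`ℓβ + ℓ(kβ) − ℓ(σβ) − ℓ(σkβ) = ℓ(N β) − ℓ(σ N β) = ℓ((1−σ_L) N_{M/L} β)`.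
(For `χ₈`: `k = σ₇`, `σ = σ₃`; for `χ₈′`: `k = σ₃`, `σ = σ₇` or `σ₅`.)  The general index-two form is
k1-g35's `charSum_norm`; this is the consumed instance. [this file] -/
theorem klein_charSum_log {ℓ : M → X} (hℓ : ∀ x y, ℓ (x * y) = ℓ x + ℓ y) (k σ : Γ) (β : M) :
    ℓ β + ℓ (k • β) - ℓ (σ • β) - ℓ ((σ * k) • β) = ℓ (β * k • β) - ℓ (σ • (β * k • β)) := by
  rw [smul_mul', mul_smul, hℓ, hℓ]
  abel

/-- The same, in `(1 − σ_L)`-form. [this file] -/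
theorem klein_charSum_log_div {ℓ : M → X} (hℓ : ∀ x y, ℓ (x * y) = ℓ x + ℓ y) (k σ : Γ) (β : M) :
    ℓ β + ℓ (k • β) - ℓ (σ • β) - ℓ ((σ * k) • β) = ℓ ((β * k • β) / σ • (β * k • β)) := by
  rw [klein_charSum_log hℓ, log_div hℓ]

end Collapse

/-! ## §2  The printed Gauss sums at `p = 2` ARE the quadratic resolvents `2√u₀`
(`ζ` a primitive 8th root of unity: `ζ⁴ = −1`; `i = ζ²`, `√2 = ζ − ζ³ = ζ + ζ⁷`, `√−2 = ζ + ζ³`) -/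

section Gauss

variable {R : Type*} [CommRing R]

/-- `g(χ₄, ψ) = Σ_{b ∈ (ℤ/4)ˣ} χ₄(b) i^b = i − i³`, `i = ζ²`. [deShalit1987 II.4.8 (19) written out; k3-g29] -/
def gauss4 (ζ : R) : R := ζ ^ 2 - ζ ^ 6
/-- `g(χ₈, ψ) = Σ_{b ∈ (ℤ/8)ˣ} χ₈(b) ζ^b = ζ − ζ³ − ζ⁵ + ζ⁷` (`χ₈ = [·,1,·,−1,·,−1,·,1]`). -/
def gauss8 (ζ : R) : R := ζ + ζ ^ 7 - ζ ^ 3 - ζ ^ 5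
/-- `g(χ₈′, ψ) = ζ + ζ³ − ζ⁵ − ζ⁷` (`χ₈′ = χ₄χ₈ = [·,1,·,1,·,−1,·,−1]`). -/
def gauss8' (ζ : R) : R := ζ - ζ ^ 7 + ζ ^ 3 - ζ ^ 5

/-- `√−1 := ζ²`, `√2 := ζ − ζ³`, `√−2 := ζ + ζ³` — the ORIENTATION OF RECORD `√u₀ := g(θ,ψ)/2`. -/
def s4 (ζ : R) : R := ζ ^ 2
def s8 (ζ : R) : R := ζ - ζ ^ 3
def s8' (ζ : R) : R := ζ + ζ ^ 3

/-- `(√−1)² = −1 = u₀(χ₄)`. -/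
theorem s4_sq (ζ : R) (h : ζ ^ 4 = -1) : s4 ζ ^ 2 = -1 := by
  unfold s4; linear_combination h

/-- `(ζ − ζ³)² = 2 = u₀(χ₈)` (`= χ₈(−1)·2^{e−2}`). -/
theorem s8_sq (ζ : R) (h : ζ ^ 4 = -1) : s8 ζ ^ 2 = 2 := by
  unfold s8; linear_combination (ζ ^ 2 - 2) * h

/-- `(ζ + ζ³)² = −2 = u₀(χ₈′)` (`= χ₈′(−1)·2^{e−2}`). -/
theorem s8'_sq (ζ : R) (h : ζ ^ 4 = -1) : s8' ζ ^ 2 = -2 := by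
  unfold s8'; linear_combination (ζ ^ 2 + 2) * h

/-- **THE GAUSS SUM IS THE RESOLVENT, `e = 2`:** `g(χ₄) = 2·√−1 = (1+√−1) − σ(1+√−1)`. [this file] -/
theorem gauss4_eq_two_mul (ζ : R) (h : ζ ^ 4 = -1) : gauss4 ζ = 2 * s4 ζ := by
  unfold gauss4 s4; linear_combination (-ζ ^ 2) * h

/-- **`e = 3`, `θ = χ₈`:** `g(χ₈) = 2·√2 = (1+√2) − σ(1+√2)`. [this file] -/
theorem gauss8_eq_two_mul (ζ : R) (h : ζ ^ 4 = -1) : gauss8 ζ = 2 * s8 ζ := by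
  unfold gauss8 s8; linear_combination (ζ ^ 3 - ζ) * h

/-- **`e = 3`, `θ = χ₈′`:** `g(χ₈′) = 2·√−2`. [this file] -/
theorem gauss8'_eq_two_mul (ζ : R) (h : ζ ^ 4 = -1) : gauss8' ζ = 2 * s8' ζ := by
  unfold gauss8' s8'; linear_combination (-ζ ^ 3 - ζ) * h

/-- `g(χ₄)² = χ₄(−1)·2² = −4` (k3-g29 `gauss_neg_four_sq`; here a corollary of `g = 2√u₀`). -/
theorem gauss4_sq (ζ : R) (h : ζ ^ 4 = -1) : gauss4 ζ ^ 2 = (-1) * 2 ^ 2 := by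
  rw [gauss4_eq_two_mul ζ h, mul_pow, s4_sq ζ h]; ring

theorem gauss8_sq (ζ : R) (h : ζ ^ 4 = -1) : gauss8 ζ ^ 2 = 1 * 2 ^ 3 := by
  rw [gauss8_eq_two_mul ζ h, mul_pow, s8_sq ζ h]; ring

theorem gauss8'_sq (ζ : R) (h : ζ ^ 4 = -1) : gauss8' ζ ^ 2 = (-1) * 2 ^ 3 := by
  rw [gauss8'_eq_two_mul ζ h, mul_pow, s8'_sq ζ h]; ring

/-- Powers of `ζ` reduce modulo `8`. -/
theorem pow_mod_eight (ζ : R) (h : ζ ^ 4 = -1) (n : ℕ) : ζ ^ n = ζ ^ (n % 8) := by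
  have h8 : ζ ^ 8 = 1 := by linear_combination (ζ ^ 4 - 1) * h
  conv_lhs => rw [← Nat.div_add_mod n 8, pow_add, pow_mul, h8, one_pow, one_mul]

/-- **de Shalit's `τ` uses `ς^{−κ(γ)}` (II.4.8 (19)):** `ḡ(θ) := g(θ, ψ̄) = g(θ, ψ)(ζ⁻¹ = ζ⁷) = θ(−1)·g(θ,ψ)`
— `χ₄(−1) = −1`. (Mathlib: `gaussSum_mulShift` at `a = −1`.) [this file] -/
theorem gauss4_inv (ζ : R) (h : ζ ^ 4 = -1) : gauss4 (ζ ^ 7) = (-1) * gauss4 ζ := by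
  unfold gauss4
  rw [← pow_mul, ← pow_mul, pow_mod_eight ζ h (7 * 2), pow_mod_eight ζ h (7 * 6)]
  norm_num

/-- `χ₈(−1) = +1`: `g(χ₈, ψ̄) = g(χ₈, ψ)`. [this file] -/
theorem gauss8_inv (ζ : R) (h : ζ ^ 4 = -1) : gauss8 (ζ ^ 7) = 1 * gauss8 ζ := by
  unfold gauss8
  rw [← pow_mul, ← pow_mul, ← pow_mul, pow_mod_eight ζ h (7 * 7), pow_mod_eight ζ h (7 * 3),
    pow_mod_eight ζ h (7 * 5)]
  norm_num
  ring

/-- `χ₈′(−1) = −1`: `g(χ₈′, ψ̄) = −g(χ₈′, ψ)`. [this file] -/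
theorem gauss8'_inv (ζ : R) (h : ζ ^ 4 = -1) : gauss8' (ζ ^ 7) = (-1) * gauss8' ζ := by
  unfold gauss8'
  rw [← pow_mul, ← pow_mul, ← pow_mul, pow_mod_eight ζ h (7 * 7), pow_mod_eight ζ h (7 * 3),
    pow_mod_eight ζ h (7 * 5)]
  norm_num
  ring

/-! ### §2b  Mathlib / tree MATCH: the hand-written sums ARE Mathlib's `gaussSum` of `ZMod.χ₄/χ₈/χ₈'`
against the additive character `AddChar.zmodChar _ ζ` — i.e. the Gauss-sum factor `Σ_b χ(b) ζ^b` of the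
tree theorem `mul_sum_mulChar_mul_μ_eq_gaussSum_mul` (II.4.8 (21) on `ℤ₂ˣ`), specialised to the three
consumed inertia types.  (de Shalit's `τ` pairs with `ς^{−κ}`: use `ζ ↦ ζ⁷` and `gaussX_inv`.) -/

theorem univ_zmod8 : (Finset.univ : Finset (ZMod 8)) = {0, 1, 2, 3, 4, 5, 6, 7} := by decide
theorem univ_zmod4 : (Finset.univ : Finset (ZMod 4)) = {0, 1, 2, 3} := by decide

/-- `gaussSum χ₈ ψ_ζ = ζ − ζ³ − ζ⁵ + ζ⁷ = gauss8 ζ`. [this file; Mathlib `gaussSum`, `ZMod.χ₈`,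
`AddChar.zmodChar`] -/
theorem gaussSum_chi8_eq (ζ : R) (hζ : ζ ^ 8 = 1) :
    gaussSum (ZMod.χ₈.ringHomComp (Int.castRingHom R)) (AddChar.zmodChar 8 hζ) = gauss8 ζ := by
  have h0 : ZMod.χ₈ (0 : ZMod 8) = 0 := by decide
  have h1 : ZMod.χ₈ (1 : ZMod 8) = 1 := by decide
  have h2 : ZMod.χ₈ (2 : ZMod 8) = 0 := by decide
  have h3 : ZMod.χ₈ (3 : ZMod 8) = -1 := by decide
  have h4 : ZMod.χ₈ (4 : ZMod 8) = 0 := by decide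
  have h5 : ZMod.χ₈ (5 : ZMod 8) = -1 := by decide
  have h6 : ZMod.χ₈ (6 : ZMod 8) = 0 := by decide
  have h7 : ZMod.χ₈ (7 : ZMod 8) = 1 := by decide
  have v0 : (0 : ZMod 8).val = 0 := by decide
  have v1 : (1 : ZMod 8).val = 1 := by decide
  have v2 : (2 : ZMod 8).val = 2 := by decide
  have v3 : (3 : ZMod 8).val = 3 := by decide
  have v4 : (4 : ZMod 8).val = 4 := by decide
  have v5 : (5 : ZMod 8).val = 5 := by decide
  have v6 : (6 : ZMod 8).val = 6 := by decide
  have v7 : (7 : ZMod 8).val = 7 := by decide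
  rw [gaussSum, univ_zmod8]
  rw [Finset.sum_insert, Finset.sum_insert, Finset.sum_insert, Finset.sum_insert, Finset.sum_insert,
    Finset.sum_insert, Finset.sum_insert, Finset.sum_singleton]
  · rw [MulChar.ringHomComp_apply, MulChar.ringHomComp_apply, MulChar.ringHomComp_apply,
      MulChar.ringHomComp_apply, MulChar.ringHomComp_apply, MulChar.ringHomComp_apply,
      MulChar.ringHomComp_apply, MulChar.ringHomComp_apply,
      h0, h1, h2, h3, h4, h5, h6, h7]
    rw [AddChar.zmodChar_apply, AddChar.zmodChar_apply, AddChar.zmodChar_apply, AddChar.zmodChar_apply,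
      AddChar.zmodChar_apply, AddChar.zmodChar_apply, AddChar.zmodChar_apply, AddChar.zmodChar_apply,
      v0, v1, v2, v3, v4, v5, v6, v7]
    simp only [map_zero, map_one, map_neg]
    unfold gauss8
    ring
  all_goals decide

/-- `gaussSum χ₈′ ψ_ζ = ζ + ζ³ − ζ⁵ − ζ⁷ = gauss8' ζ`. [this file] -/
theorem gaussSum_chi8'_eq (ζ : R) (hζ : ζ ^ 8 = 1) :
    gaussSum (ZMod.χ₈'.ringHomComp (Int.castRingHom R)) (AddChar.zmodChar 8 hζ) = gauss8' ζ := by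
  have h0 : ZMod.χ₈' (0 : ZMod 8) = 0 := by decide
  have h1 : ZMod.χ₈' (1 : ZMod 8) = 1 := by decide
  have h2 : ZMod.χ₈' (2 : ZMod 8) = 0 := by decide
  have h3 : ZMod.χ₈' (3 : ZMod 8) = 1 := by decide
  have h4 : ZMod.χ₈' (4 : ZMod 8) = 0 := by decide
  have h5 : ZMod.χ₈' (5 : ZMod 8) = -1 := by decide
  have h6 : ZMod.χ₈' (6 : ZMod 8) = 0 := by decide
  have h7 : ZMod.χ₈' (7 : ZMod 8) = -1 := by decide
  have v0 : (0 : ZMod 8).val = 0 := by decide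
  have v1 : (1 : ZMod 8).val = 1 := by decide
  have v2 : (2 : ZMod 8).val = 2 := by decide
  have v3 : (3 : ZMod 8).val = 3 := by decide
  have v4 : (4 : ZMod 8).val = 4 := by decide
  have v5 : (5 : ZMod 8).val = 5 := by decide
  have v6 : (6 : ZMod 8).val = 6 := by decide
  have v7 : (7 : ZMod 8).val = 7 := by decide
  rw [gaussSum, univ_zmod8]
  rw [Finset.sum_insert, Finset.sum_insert, Finset.sum_insert, Finset.sum_insert, Finset.sum_insert,
    Finset.sum_insert, Finset.sum_insert, Finset.sum_singleton]
  · rw [MulChar.ringHomComp_apply, MulChar.ringHomComp_apply, MulChar.ringHomComp_apply,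
      MulChar.ringHomComp_apply, MulChar.ringHomComp_apply, MulChar.ringHomComp_apply,
      MulChar.ringHomComp_apply, MulChar.ringHomComp_apply,
      h0, h1, h2, h3, h4, h5, h6, h7]
    rw [AddChar.zmodChar_apply, AddChar.zmodChar_apply, AddChar.zmodChar_apply, AddChar.zmodChar_apply,
      AddChar.zmodChar_apply, AddChar.zmodChar_apply, AddChar.zmodChar_apply, AddChar.zmodChar_apply,
      v0, v1, v2, v3, v4, v5, v6, v7]
    simp only [map_zero, map_one, map_neg]
    unfold gauss8'
    ring
  all_goals decide

/-- `gaussSum χ₄ ψ_i = i − i³ = gauss4 ζ` for `i = ζ²`. [this file] -/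
theorem gaussSum_chi4_eq (i : R) (hi : i ^ 4 = 1) :
    gaussSum (ZMod.χ₄.ringHomComp (Int.castRingHom R)) (AddChar.zmodChar 4 hi) = i - i ^ 3 := by
  have h0 : ZMod.χ₄ (0 : ZMod 4) = 0 := by decide
  have h1 : ZMod.χ₄ (1 : ZMod 4) = 1 := by decide
  have h2 : ZMod.χ₄ (2 : ZMod 4) = 0 := by decide
  have h3 : ZMod.χ₄ (3 : ZMod 4) = -1 := by decide
  have v0 : (0 : ZMod 4).val = 0 := by decide
  have v1 : (1 : ZMod 4).val = 1 := by decide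
  have v2 : (2 : ZMod 4).val = 2 := by decide
  have v3 : (3 : ZMod 4).val = 3 := by decide
  rw [gaussSum, univ_zmod4]
  rw [Finset.sum_insert, Finset.sum_insert, Finset.sum_insert, Finset.sum_singleton]
  · rw [MulChar.ringHomComp_apply, MulChar.ringHomComp_apply, MulChar.ringHomComp_apply,
      MulChar.ringHomComp_apply, h0, h1, h2, h3]
    rw [AddChar.zmodChar_apply, AddChar.zmodChar_apply, AddChar.zmodChar_apply, AddChar.zmodChar_apply,
      v0, v1, v2, v3]
    simp only [map_zero, map_one, map_neg]
    ring
  all_goals decide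

/-- … and `i − i³ = gauss4 ζ` when `i = ζ²`. [this file] -/
theorem gauss4_eq_of_sq (ζ : R) : (ζ ^ 2) - (ζ ^ 2) ^ 3 = gauss4 ζ := by
  unfold gauss4; ring

/-- **Generic bridge (tree ↔ Mathlib):** the Gauss factor `Σ_b χ(b) ζ^b` of the tree theorem
`BoundedDistribution.mul_sum_mulChar_mul_μ_eq_gaussSum_mul` IS Mathlib's `gaussSum χ (zmodChar N ζ)`.
[this file; the tree proves the same line internally as `hg`] -/
theorem sum_mulChar_mul_pow_eq_gaussSum {N : ℕ} [NeZero N] (χ : MulChar (ZMod N) R) {ζ : R}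
    (hζ : ζ ^ N = 1) : ∑ b : ZMod N, χ b * ζ ^ b.val = gaussSum χ (AddChar.zmodChar N hζ) := by
  rw [gaussSum]
  exact Finset.sum_congr rfl fun b _ ↦ by rw [AddChar.zmodChar_apply]

/-- The values `θ(−1)`: `χ₄(−1) = −1`, `χ₈(−1) = 1`, `χ₈′(−1) = −1` (Mathlib's characters). -/
theorem chi4_neg_one : ZMod.χ₄ (-1 : ZMod 4) = -1 := by decide
theorem chi8_neg_one : ZMod.χ₈ (-1 : ZMod 8) = 1 := by decide
theorem chi8'_neg_one : ZMod.χ₈' (-1 : ZMod 8) = -1 := by decide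

/-- The kernels (`L = M^{ker θ}`): `ker χ₈ = {1, 7}` (`k = σ₇`), `ker χ₈′ = {1, 3}` (`k = σ₃`). -/
theorem chi8_ker : ZMod.χ₈ (1 : ZMod 8) = 1 ∧ ZMod.χ₈ (7 : ZMod 8) = 1 ∧
    ZMod.χ₈ (3 : ZMod 8) = -1 ∧ ZMod.χ₈ (5 : ZMod 8) = -1 := by decide
theorem chi8'_ker : ZMod.χ₈' (1 : ZMod 8) = 1 ∧ ZMod.χ₈' (3 : ZMod 8) = 1 ∧
    ZMod.χ₈' (5 : ZMod 8) = -1 ∧ ZMod.χ₈' (7 : ZMod 8) = -1 := by decide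

end Gauss

/-! ### §2b′  PRIMITIVITY DISCHARGED: the tree engine's hypothesis `χ.IsPrimitive` («`e` is the exact power of
`𝔭` in `𝔣_χ`») holds for the three consumed types — `χ₈(5) = χ₈′(5) = −1` with `5 ≡ 1 (4)`, `χ₄(3) = −1`
with `3 ≡ 1 (2)` (Mathlib `factorsThrough_iff_ker_unitsMap`, `mem_conductorSet_iff_conductor_dvd`). -/

section Primitivity

open DirichletCharacter

/-- `χ₈` is primitive of conductor `8 = 2^{2+1}` over any ring with `−1 ≠ 1`. [this file] -/
theorem chi8_isPrimitive {𝕜 : Type*} [CommRing 𝕜] (hneg : (-1 : 𝕜) ≠ 1) :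
    @DirichletCharacter.IsPrimitive 𝕜 _ (2 ^ (2 + 1)) (ZMod.χ₈.ringHomComp (Int.castRingHom 𝕜)) := by
  set χ : DirichletCharacter 𝕜 8 := ZMod.χ₈.ringHomComp (Int.castRingHom 𝕜) with hχdef
  show χ.conductor = 8
  have hdvd : χ.conductor ∣ 8 := χ.conductor_dvd_level
  have hnot : ¬ χ.conductor ∣ 4 := by
    intro h4
    have hft : χ.FactorsThrough 4 :=
      (mem_conductorSet_iff_conductor_dvd χ (by norm_num : 4 ∣ 8)).mpr h4
    rw [factorsThrough_iff_ker_unitsMap (by norm_num : 4 ∣ 8)] at hft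
    let u : (ZMod 8)ˣ := ZMod.unitOfCoprime 5 (by norm_num)
    have hu : (u : ZMod 8) = 5 := rfl
    have hker : u ∈ (ZMod.unitsMap (by norm_num : 4 ∣ 8)).ker := by
      rw [MonoidHom.mem_ker]
      ext
      rw [ZMod.unitsMap_val, hu, Units.val_one]
      decide
    have h1 := hft hker
    rw [MonoidHom.mem_ker] at h1
    have hval : ((χ.toUnitHom u : 𝕜ˣ) : 𝕜) = -1 := by
      rw [MulChar.coe_toUnitHom, hu, hχdef, MulChar.ringHomComp_apply]
      have : ZMod.χ₈ (5 : ZMod 8) = -1 := by decide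
      rw [this]; simp
    rw [h1, Units.val_one] at hval
    exact hneg hval.symm
  have hmem : χ.conductor ∈ Nat.divisors 8 := Nat.mem_divisors.mpr ⟨hdvd, by norm_num⟩
  have h8 : Nat.divisors 8 = {1, 2, 4, 8} := by decide
  rw [h8] at hmem
  simp only [Finset.mem_insert, Finset.mem_singleton] at hmem
  rcases hmem with h | h | h | h
  · rw [h] at hnot; exact absurd (by norm_num) hnot
  · rw [h] at hnot; exact absurd (by norm_num) hnot
  · rw [h] at hnot; exact absurd (dvd_refl 4) hnot
  · exact h

/-- `χ₈′` is primitive of conductor `8`. [this file] -/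
theorem chi8'_isPrimitive {𝕜 : Type*} [CommRing 𝕜] (hneg : (-1 : 𝕜) ≠ 1) :
    @DirichletCharacter.IsPrimitive 𝕜 _ (2 ^ (2 + 1)) (ZMod.χ₈'.ringHomComp (Int.castRingHom 𝕜)) := by
  set χ : DirichletCharacter 𝕜 8 := ZMod.χ₈'.ringHomComp (Int.castRingHom 𝕜) with hχdef
  show χ.conductor = 8
  have hdvd : χ.conductor ∣ 8 := χ.conductor_dvd_level
  have hnot : ¬ χ.conductor ∣ 4 := by
    intro h4
    have hft : χ.FactorsThrough 4 :=
      (mem_conductorSet_iff_conductor_dvd χ (by norm_num : 4 ∣ 8)).mpr h4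
    rw [factorsThrough_iff_ker_unitsMap (by norm_num : 4 ∣ 8)] at hft
    let u : (ZMod 8)ˣ := ZMod.unitOfCoprime 5 (by norm_num)
    have hu : (u : ZMod 8) = 5 := rfl
    have hker : u ∈ (ZMod.unitsMap (by norm_num : 4 ∣ 8)).ker := by
      rw [MonoidHom.mem_ker]
      ext
      rw [ZMod.unitsMap_val, hu, Units.val_one]
      decide
    have h1 := hft hker
    rw [MonoidHom.mem_ker] at h1
    have hval : ((χ.toUnitHom u : 𝕜ˣ) : 𝕜) = -1 := by
      rw [MulChar.coe_toUnitHom, hu, hχdef, MulChar.ringHomComp_apply]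
      have : ZMod.χ₈' (5 : ZMod 8) = -1 := by decide
      rw [this]; simp
    rw [h1, Units.val_one] at hval
    exact hneg hval.symm
  have hmem : χ.conductor ∈ Nat.divisors 8 := Nat.mem_divisors.mpr ⟨hdvd, by norm_num⟩
  have h8 : Nat.divisors 8 = {1, 2, 4, 8} := by decide
  rw [h8] at hmem
  simp only [Finset.mem_insert, Finset.mem_singleton] at hmem
  rcases hmem with h | h | h | h
  · rw [h] at hnot; exact absurd (by norm_num) hnot
  · rw [h] at hnot; exact absurd (by norm_num) hnot
  · rw [h] at hnot; exact absurd (dvd_refl 4) hnot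
  · exact h

/-- `χ₄` is primitive of conductor `4 = 2^{1+1}`. [this file] -/
theorem chi4_isPrimitive {𝕜 : Type*} [CommRing 𝕜] (hneg : (-1 : 𝕜) ≠ 1) :
    @DirichletCharacter.IsPrimitive 𝕜 _ (2 ^ (1 + 1)) (ZMod.χ₄.ringHomComp (Int.castRingHom 𝕜)) := by
  set χ : DirichletCharacter 𝕜 4 := ZMod.χ₄.ringHomComp (Int.castRingHom 𝕜) with hχdef
  show χ.conductor = 4
  have hdvd : χ.conductor ∣ 4 := χ.conductor_dvd_level
  have hnot : ¬ χ.conductor ∣ 2 := by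
    intro h2
    have hft : χ.FactorsThrough 2 :=
      (mem_conductorSet_iff_conductor_dvd χ (by norm_num : 2 ∣ 4)).mpr h2
    rw [factorsThrough_iff_ker_unitsMap (by norm_num : 2 ∣ 4)] at hft
    let u : (ZMod 4)ˣ := ZMod.unitOfCoprime 3 (by norm_num)
    have hu : (u : ZMod 4) = 3 := rfl
    have hker : u ∈ (ZMod.unitsMap (by norm_num : 2 ∣ 4)).ker := by
      rw [MonoidHom.mem_ker]
      ext
      rw [ZMod.unitsMap_val, hu, Units.val_one]
      decide
    have h1 := hft hker
    rw [MonoidHom.mem_ker] at h1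
    have hval : ((χ.toUnitHom u : 𝕜ˣ) : 𝕜) = -1 := by
      rw [MulChar.coe_toUnitHom, hu, hχdef, MulChar.ringHomComp_apply]
      have : ZMod.χ₄ (3 : ZMod 4) = -1 := by decide
      rw [this]; simp
    rw [h1, Units.val_one] at hval
    exact hneg hval.symm
  have hmem : χ.conductor ∈ Nat.divisors 4 := Nat.mem_divisors.mpr ⟨hdvd, by norm_num⟩
  have h4 : Nat.divisors 4 = {1, 2, 4} := by decide
  rw [h4] at hmem
  simp only [Finset.mem_insert, Finset.mem_singleton] at hmem
  rcases hmem with h | h | h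
  · rw [h] at hnot; exact absurd (by norm_num) hnot
  · rw [h] at hnot; exact absurd (dvd_refl 2) hnot
  · exact h

end Primitivity

/-! ## §2c  TREE ENGINE PLUG (typing B of the atom (KLF-COSET)₂, first factor): de Shalit II.4.8 (21)
on `ℤ₂ˣ` = tree `BoundedDistribution.mul_sum_mulChar_mul_μ_eq_gaussSum_mul`, with its Gauss factor in
RESOLVENT FORM `2·√u₀` — for ANY bounded distribution `D` on `ℤ₂` (the `col` column's one-variable
avatar) and the consumed primitive type. -/

section TreeEngine

open Literature.NumberTheory.EllipticCurves

variable {p : ℕ} [Fact p.Prime] {𝕜 : Type*} [NormedField 𝕜]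

/-- **The tree's table identity with the Gauss factor as a resolvent:** if `Σ_b χ(b)ζ^b = 2·s` then
`p^{n+1}·Σ_b χ(b) D(b + p^{n+1}ℤ_p) = (2·s)·Σ_{j} χ⁻¹(−j)·charSum D (n+1) (ζ^j)`.
[tree: `mul_sum_mulChar_mul_μ_eq_gaussSum_mul` = deShalit1987 II.4.8 (19)–(21) p. 61; this file] -/
theorem tree_table_resolvent_form (D : BoundedDistribution (ProfiniteTower.padicInt p) 𝕜) (n : ℕ)
    {ζ : 𝕜} (hζ : IsPrimitiveRoot ζ (p ^ (n + 1))) (χ : DirichletCharacter 𝕜 (p ^ (n + 1)))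
    (hχ : χ.IsPrimitive) (s : 𝕜) (hg : ∑ b : ZMod (p ^ (n + 1)), χ b * ζ ^ b.val = 2 * s) :
    ((p ^ (n + 1) : ℕ) : 𝕜) * ∑ b : ZMod (p ^ (n + 1)), χ b * D.μ (n + 1) b =
      2 * s * ∑ j ∈ Finset.range (p ^ (n + 1)),
        χ⁻¹ (-(j : ZMod (p ^ (n + 1)))) * D.charSum (n + 1) (ζ ^ j) := by
  rw [D.mul_sum_mulChar_mul_μ_eq_gaussSum_mul n hζ χ hχ, hg]

/-- A primitive 8th root of unity in a field has `ζ⁴ = −1`. [this file] -/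
theorem pow_four_eq_neg_one_of_isPrimitiveRoot_eight {K : Type*} [Field K] {ζ : K}
    (hζ : IsPrimitiveRoot ζ 8) : ζ ^ 4 = -1 := by
  have h8 : ζ ^ 8 = 1 := hζ.pow_eq_one
  have h4 : ζ ^ 4 ≠ 1 := hζ.pow_ne_one_of_pos_of_lt (by norm_num) (by norm_num)
  have hsq : ζ ^ 4 * ζ ^ 4 = 1 := by rw [← pow_add]; exact h8
  rcases mul_self_eq_one_iff.mp hsq with h | h
  · exact absurd h h4
  · exact h

/-- **Consumed instance `e = 3`, `θ = χ₈` (keys `u ∈ {2, −6}`), level `8 = 2^{2+1}`:** the tree's (21) on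
`ℤ₂ˣ` for ANY bounded distribution `D` on `ℤ₂`, with the Gauss factor EVALUATED as the resolvent
`2·(ζ − ζ³) = 2√2` (`gaussSum_chi8_eq` + `gauss8_eq_two_mul`).  (`χ₈'`, `χ₄`: verbatim with
`gaussSum_chi8'_eq` / `gaussSum_chi4_eq`.)  Primitivity of `χ₈` mod `8` is the hypothesis `hχ`.
[this file] -/
theorem tree_table_condEight_chi8 {𝕜 : Type*} [NormedField 𝕜]
    (D : BoundedDistribution (ProfiniteTower.padicInt 2) 𝕜) {ζ : 𝕜}
    (hζ : IsPrimitiveRoot ζ (2 ^ (2 + 1)))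
    (hχ : @DirichletCharacter.IsPrimitive 𝕜 _ (2 ^ (2 + 1)) (ZMod.χ₈.ringHomComp (Int.castRingHom 𝕜))) :
    ((2 ^ (2 + 1) : ℕ) : 𝕜) * ∑ b : ZMod (2 ^ (2 + 1)),
        (ZMod.χ₈.ringHomComp (Int.castRingHom 𝕜)) b * D.μ (2 + 1) b =
      2 * s8 ζ * ∑ j ∈ Finset.range (2 ^ (2 + 1)),
        (ZMod.χ₈.ringHomComp (Int.castRingHom 𝕜) : DirichletCharacter 𝕜 (2 ^ (2 + 1)))⁻¹
          (-(j : ZMod (2 ^ (2 + 1)))) * D.charSum (2 + 1) (ζ ^ j) := by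
  have h8 : ζ ^ 8 = 1 := hζ.pow_eq_one
  have h4 : ζ ^ 4 = -1 := pow_four_eq_neg_one_of_isPrimitiveRoot_eight hζ
  refine tree_table_resolvent_form D 2 hζ _ hχ (s8 ζ) ?_
  rw [sum_mulChar_mul_pow_eq_gaussSum _ hζ.pow_eq_one, ← gauss8_eq_two_mul ζ h4]
  exact gaussSum_chi8_eq ζ h8

/-- Consumed instance `e = 3`, `θ = χ₈′ = χ₄χ₈` (keys `u ∈ {−2, 6}`): Gauss factor `2·(ζ + ζ³) = 2√−2`.
[this file] -/
theorem tree_table_condEight_chi8' {𝕜 : Type*} [NormedField 𝕜]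
    (D : BoundedDistribution (ProfiniteTower.padicInt 2) 𝕜) {ζ : 𝕜}
    (hζ : IsPrimitiveRoot ζ (2 ^ (2 + 1)))
    (hχ : @DirichletCharacter.IsPrimitive 𝕜 _ (2 ^ (2 + 1)) (ZMod.χ₈'.ringHomComp (Int.castRingHom 𝕜))) :
    ((2 ^ (2 + 1) : ℕ) : 𝕜) * ∑ b : ZMod (2 ^ (2 + 1)),
        (ZMod.χ₈'.ringHomComp (Int.castRingHom 𝕜)) b * D.μ (2 + 1) b =
      2 * s8' ζ * ∑ j ∈ Finset.range (2 ^ (2 + 1)),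
        (ZMod.χ₈'.ringHomComp (Int.castRingHom 𝕜) : DirichletCharacter 𝕜 (2 ^ (2 + 1)))⁻¹
          (-(j : ZMod (2 ^ (2 + 1)))) * D.charSum (2 + 1) (ζ ^ j) := by
  have h8 : ζ ^ 8 = 1 := hζ.pow_eq_one
  have h4 : ζ ^ 4 = -1 := pow_four_eq_neg_one_of_isPrimitiveRoot_eight hζ
  refine tree_table_resolvent_form D 2 hζ _ hχ (s8' ζ) ?_
  rw [sum_mulChar_mul_pow_eq_gaussSum _ hζ.pow_eq_one, ← gauss8'_eq_two_mul ζ h4]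
  exact gaussSum_chi8'_eq ζ h8

/-- A primitive 4th root of unity in a field has `i² = −1`. [this file] -/
theorem pow_two_eq_neg_one_of_isPrimitiveRoot_four {K : Type*} [Field K] {i : K}
    (hi : IsPrimitiveRoot i 4) : i ^ 2 = -1 := by
  have h4 : i ^ 4 = 1 := hi.pow_eq_one
  have h2 : i ^ 2 ≠ 1 := hi.pow_ne_one_of_pos_of_lt (by norm_num) (by norm_num)
  have hsq : i ^ 2 * i ^ 2 = 1 := by rw [← pow_add]; exact h4
  rcases mul_self_eq_one_iff.mp hsq with h | h
  · exact absurd h h2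
  · exact h

/-- Consumed instance `e = 2`, `θ = χ₄` (keys `u ∈ {−1, 3}`), level `4 = 2^{1+1}`: Gauss factor
`i − i³ = 2i = 2√−1`. [this file] -/
theorem tree_table_condFour_chi4 {𝕜 : Type*} [NormedField 𝕜]
    (D : BoundedDistribution (ProfiniteTower.padicInt 2) 𝕜) {i : 𝕜}
    (hi : IsPrimitiveRoot i (2 ^ (1 + 1)))
    (hχ : @DirichletCharacter.IsPrimitive 𝕜 _ (2 ^ (1 + 1)) (ZMod.χ₄.ringHomComp (Int.castRingHom 𝕜))) :
    ((2 ^ (1 + 1) : ℕ) : 𝕜) * ∑ b : ZMod (2 ^ (1 + 1)),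
        (ZMod.χ₄.ringHomComp (Int.castRingHom 𝕜)) b * D.μ (1 + 1) b =
      2 * i * ∑ j ∈ Finset.range (2 ^ (1 + 1)),
        (ZMod.χ₄.ringHomComp (Int.castRingHom 𝕜) : DirichletCharacter 𝕜 (2 ^ (1 + 1)))⁻¹
          (-(j : ZMod (2 ^ (1 + 1)))) * D.charSum (1 + 1) (i ^ j) := by
  have h4 : i ^ 4 = 1 := hi.pow_eq_one
  have h2 : i ^ 2 = -1 := pow_two_eq_neg_one_of_isPrimitiveRoot_four hi
  refine tree_table_resolvent_form D 1 hi _ hχ i ?_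
  rw [sum_mulChar_mul_pow_eq_gaussSum _ hi.pow_eq_one]
  have hev := gaussSum_chi4_eq i h4
  have h3 : i - i ^ 3 = 2 * i := by linear_combination (-i) * h2
  rw [h3] at hev
  exact hev

/-- **Hypothesis-free consumed instance** (`e = 3`, `θ = χ₈`): only `D`, `ζ` and `−1 ≠ 1` remain. [this file] -/
theorem tree_table_condEight_chi8_unconditional {𝕜 : Type*} [NormedField 𝕜] (hneg : (-1 : 𝕜) ≠ 1)
    (D : BoundedDistribution (ProfiniteTower.padicInt 2) 𝕜) {ζ : 𝕜}
    (hζ : IsPrimitiveRoot ζ (2 ^ (2 + 1))) :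
    ((2 ^ (2 + 1) : ℕ) : 𝕜) * ∑ b : ZMod (2 ^ (2 + 1)),
        (ZMod.χ₈.ringHomComp (Int.castRingHom 𝕜)) b * D.μ (2 + 1) b =
      2 * s8 ζ * ∑ j ∈ Finset.range (2 ^ (2 + 1)),
        (ZMod.χ₈.ringHomComp (Int.castRingHom 𝕜) : DirichletCharacter 𝕜 (2 ^ (2 + 1)))⁻¹
          (-(j : ZMod (2 ^ (2 + 1)))) * D.charSum (2 + 1) (ζ ^ j) :=
  tree_table_condEight_chi8 D hζ (chi8_isPrimitive hneg)

/-- **Power-series (Amice) form at the consumed instance `e = 3`, `θ = χ₈`:** for a BOUNDED power series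
`P` over a complete ultrametric `ℚ₂`-algebra (the slot for de Shalit's `ã_{σ_𝔠β(𝔞)} = log g̃ ∘ θ ∈ 𝒪[[S]]`,
I.3.3 (8)), `8·∫ χ₈(x mod 8) d(invAmice₁ P) = 2(ζ − ζ³) · Σ_{j<8} χ₈⁻¹(−j) · P(ζ^j − 1)` — the tree's
`mul_integral_mulChar_invAmice₁_eq_gaussSum_mul` with its Gauss factor evaluated.  [tree; this file] -/
theorem tree_amice_condEight_chi8 {𝕜 : Type*} [NormedField 𝕜] [NormedAlgebra ℚ_[2] 𝕜]
    [IsUltrametricDist 𝕜] [CompleteSpace 𝕜] {P : PowerSeries 𝕜} {C : ℝ}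
    (hC : ∀ m, ‖PowerSeries.coeff m P‖ ≤ C) {ζ : 𝕜} (hζ : IsPrimitiveRoot ζ (2 ^ (2 + 1)))
    (hχ : @DirichletCharacter.IsPrimitive 𝕜 _ (2 ^ (2 + 1)) (ZMod.χ₈.ringHomComp (Int.castRingHom 𝕜))) :
    ((2 ^ (2 + 1) : ℕ) : 𝕜) *
        (invAmice₁ 2 P hC).integral
          (fun x : ℤ_[2] ↦ (ZMod.χ₈.ringHomComp (Int.castRingHom 𝕜)) (PadicInt.toZModPow (2 + 1) x)) =
      2 * s8 ζ * ∑ j ∈ Finset.range (2 ^ (2 + 1)),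
        (ZMod.χ₈.ringHomComp (Int.castRingHom 𝕜) : DirichletCharacter 𝕜 (2 ^ (2 + 1)))⁻¹
            (-(j : ZMod (2 ^ (2 + 1)))) *
          ∑' m : ℕ, PowerSeries.coeff m P * (ζ ^ j - 1) ^ m := by
  have h8 : ζ ^ 8 = 1 := hζ.pow_eq_one
  have h4 : ζ ^ 4 = -1 := pow_four_eq_neg_one_of_isPrimitiveRoot_eight hζ
  have hg : ∑ b : ZMod (2 ^ (2 + 1)), (ZMod.χ₈.ringHomComp (Int.castRingHom 𝕜)) b * ζ ^ b.val =
      2 * s8 ζ := by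
    rw [sum_mulChar_mul_pow_eq_gaussSum _ hζ.pow_eq_one, ← gauss8_eq_two_mul ζ h4]
    exact gaussSum_chi8_eq ζ h8
  rw [mul_integral_mulChar_invAmice₁_eq_gaussSum_mul hC 2 hζ _ hχ, hg]

end TreeEngine

/-! ## §5  (7′)-INVISIBILITY ON THE COSET at `p = 2` (bridge B2): de Shalit I.3.3 (7′) p. 17,
`P̃(S) = P(S) − ½·Σ_{η² = 1} P(η(1+S) − 1)` (or `P − ½(φP)((1+S)² − 1)`): at the level-`2^e` points
`S = ζ^j − 1` the correction is `t`-PERIODIC in `j` (`t = 2^{e−1}`), while the coset weight `θ̄(−j)` is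
`t`-ANTIPERIODIC (`χ₈(x+4) = −χ₈(x)`, `χ₈′(x+4) = −χ₈′(x)`, `χ₄(x+2) = −χ₄(x)`): the `½` never enters the
coset value («the formula remains valid with `a_β` instead of `ã_β`», I.3.6 p. 19; (20) uses plain `log`). -/

section Invisibility

variable {K : Type*} [Field K]

/-- `χ₈(x + 4) = −χ₈(x)` on `ℤ/8` (non-units: `0 = −0`). [this file] -/
theorem chi8_antiperiodic : ∀ x : ZMod 8, ZMod.χ₈ (x + 4) = -ZMod.χ₈ x := by decide

/-- `χ₈′(x + 4) = −χ₈′(x)` on `ℤ/8`. [this file] -/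
theorem chi8'_antiperiodic : ∀ x : ZMod 8, ZMod.χ₈' (x + 4) = -ZMod.χ₈' x := by decide

/-- `χ₄(x + 2) = −χ₄(x)` on `ℤ/4`. [this file] -/
theorem chi4_antiperiodic : ∀ x : ZMod 4, ZMod.χ₄ (x + 2) = -ZMod.χ₄ x := by decide

/-- The coset weight `j ↦ θ(−j)` inherits antiperiodicity. [this file] -/
theorem neg_arg_antiperiodic {N : ℕ} (θ : ZMod N → ℤ) (t : ZMod N)
    (h : ∀ x, θ (x + t) = -θ x) : ∀ x, θ (-(x + t)) = -θ (-x) := by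
  intro x
  have := h (-(x + t))
  rw [show -(x + t) + t = -x by ring] at this
  -- this : θ (-x) = -θ (-(x+t))
  rw [this, neg_neg]

/-- **Antiperiodic weight × periodic function sums to zero** (`2 ≠ 0`). [this file] -/
theorem sum_antiperiodic_mul_periodic_eq_zero {N : ℕ} [NeZero N] (h2 : (2 : K) ≠ 0)
    (w c : ZMod N → K) (t : ZMod N) (hw : ∀ x, w (x + t) = -w x) (hc : ∀ x, c (x + t) = c x) :
    ∑ j, w j * c j = 0 := by
  have hre : ∑ j, w (j + t) * c (j + t) = ∑ j, w j * c j :=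
    Equiv.sum_comp (Equiv.addRight t) (fun j ↦ w j * c j)
  have hneg : ∑ j, w (j + t) * c (j + t) = -∑ j, w j * c j := by
    rw [← Finset.sum_neg_distrib]
    exact Finset.sum_congr rfl fun j _ ↦ by rw [hw, hc, neg_mul]
  have h : (2 : K) * ∑ j, w j * c j = 0 := by rw [two_mul]; nth_rw 1 [← hre]; rw [hneg]; ring
  rcases mul_eq_zero.mp h with h | h
  · exact absurd h h2
  · exact h

/-- **(7′)-invisibility on the coset:** replacing the plain values `L j = a(ζ^j − 1)` by the normalised
ones `L j − κ·C j` with a `t`-periodic correction `C` does not change the `θ̄(−j)`-weighted sum. [this file] -/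
theorem coset_sum_correction_invisible {N : ℕ} [NeZero N] (h2 : (2 : K) ≠ 0)
    (w L C : ZMod N → K) (κ : K) (t : ZMod N) (hw : ∀ x, w (x + t) = -w x)
    (hC : ∀ x, C (x + t) = C x) :
    ∑ j, w j * (L j - κ * C j) = ∑ j, w j * L j := by
  have h0 := sum_antiperiodic_mul_periodic_eq_zero h2 w C t hw hC
  have : ∑ j, w j * (L j - κ * C j) = ∑ j, w j * L j - κ * ∑ j, w j * C j := by
    rw [Finset.mul_sum, ← Finset.sum_sub_distrib]
    exact Finset.sum_congr rfl fun j _ ↦ by ring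
  rw [this, h0, mul_zero, sub_zero]

/-- The (7′)-correction `C j := a(ζ^j − 1) + a(ζ^{j+t} − 1)` (`η = ζ^t = −1`) is `t`-periodic when
`2t = 0` in `ℤ/N`. [this file] -/
theorem correction_periodic {N : ℕ} (a : ZMod N → K) (t : ZMod N) (h2t : t + t = 0) :
    ∀ x, (fun j ↦ a j + a (j + t)) (x + t) = (fun j ↦ a j + a (j + t)) x := by
  intro x
  show a (x + t) + a (x + t + t) = a x + a (x + t)
  rw [add_assoc x t t, h2t, add_zero, add_comm]

/-- Consumed instance `e = 3`, `θ = χ₈`: the `½`-correction is invisible in `Σ_j χ₈(−j)·(…)`. [this file] -/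
theorem coset_sum_correction_invisible_chi8 (h2 : (2 : K) ≠ 0) (L C : ZMod 8 → K) (κ : K)
    (hC : ∀ x, C (x + 4) = C x) :
    ∑ j, (ZMod.χ₈ (-j) : K) * (L j - κ * C j) = ∑ j, (ZMod.χ₈ (-j) : K) * L j := by
  refine coset_sum_correction_invisible h2 _ L C κ 4 (fun x ↦ ?_) hC
  have h : (ZMod.χ₈ (-(x + 4)) : ℤ) = -(ZMod.χ₈ (-x) : ℤ) :=
    neg_arg_antiperiodic (fun y ↦ (ZMod.χ₈ y : ℤ)) 4 chi8_antiperiodic x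
  show ((ZMod.χ₈ (-(x + 4)) : ℤ) : K) = -((ZMod.χ₈ (-x) : ℤ) : K)
  rw [h, Int.cast_neg]

end Invisibility

/-! ## §6  REINDEXING `j ↔ γ` (bridge B3): de Shalit II.4.8 (22)₀ / Prop. II.4.5(iv)
`log(g_{γβ}∘θ)(ς − 1) = log(g_β∘θ)(ς^{κ(γ)} − 1)`: the tree's unit-indexed sum `Σ_j χ̄(−j)·P(ζ^j − 1)`
is the Galois-indexed sum `Σ_{γ ∈ Gal(F_e/F)} χ̄(−κ̄γ)·δ_{0,e}(γβ)` along `κ̄ : Gal(F_e/F) ≃ (ℤ/2^e)ˣ`;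
non-units are silent because `χ̄` vanishes there. -/

section Reindex

variable {R : Type*} [CommRing R]

/-- A multiplicative character sum over `ℤ/N` only sees the units. [this file] -/
theorem sum_mulChar_mul_eq_sum_units {N : ℕ} [NeZero N] (χ : MulChar (ZMod N) R) (f : ZMod N → R) :
    ∑ j : ZMod N, χ j * f j = ∑ u : (ZMod N)ˣ, χ u * f u := by
  classical
  have hsplit : ∑ j : ZMod N, χ j * f j =
      ∑ j ∈ (Finset.univ : Finset (ZMod N)).filter IsUnit, χ j * f j := by
    rw [Finset.sum_filter]
    refine Finset.sum_congr rfl fun j _ ↦ ?_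
    split_ifs with hj
    · rfl
    · rw [χ.map_nonunit hj, zero_mul]
  rw [hsplit]
  refine Finset.sum_bij' (fun j hj ↦ (Finset.mem_filter.mp hj).2.unit) (fun u _ ↦ (u : ZMod N))
    (fun j hj ↦ Finset.mem_univ _) (fun u _ ↦ Finset.mem_filter.mpr ⟨Finset.mem_univ _, u.isUnit⟩)
    (fun j hj ↦ by simp) (fun u _ ↦ by ext; simp) (fun j hj ↦ by simp)

/-- **(22)₀ as a reindexing:** along `κ̄ : Γ ≃ (ℤ/N)ˣ` with `P(κ̄ γ) = δ γ` (Prop. II.4.5(iv)),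
`Σ_j χ(j)·P j = Σ_γ χ(κ̄ γ)·δ γ`. [this file] -/
theorem sum_mulChar_reindex_galois {N : ℕ} [NeZero N] {Γ : Type*} [Fintype Γ]
    (χ : MulChar (ZMod N) R) (P : ZMod N → R) (κbar : Γ ≃ (ZMod N)ˣ) (δ : Γ → R)
    (hev : ∀ γ, P (κbar γ) = δ γ) :
    ∑ j : ZMod N, χ j * P j = ∑ γ, χ (κbar γ) * δ γ := by
  rw [sum_mulChar_mul_eq_sum_units, ← κbar.sum_comp]
  exact Finset.sum_congr rfl fun γ _ ↦ by rw [hev]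

end Reindex

/-! ## §3  The seam constant: `τ_dS ⊗ resolvent = θ(−1)² = 1` in `g`-currency -/

section Seam

variable {K : Type*} [Field K]

/-- **SEAM CONSTANT ONE (the `(R2) ⊕ resolvent` seam of `c(key)`, R200′(b′)(c)).**  Data, all in a field
`K ∋ ζ₈` of characteristic `≠ 2` (e.g. `ℂ₂`):
* `hI`  — the printed table on the consumed coset, II.5.2 (3) × `2^e` with II.4.8 (19):
          `2^e · I = ḡ · S`, `I = ∫_𝒢 χ⁻¹ dμ_𝔞` (one `Gal(F/K)`-summand), `S = Σ_{γ∈Gal(M/F)} θ(γ) log(γx)^{σ_𝔮}`;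
* `hbar` — `ḡ = θ(−1)·g` (`gaussX_inv` / Mathlib `gaussSum_mulShift`);
* `hS`  — the `θ`-column home + `g`-currency: `S = log((1−σ_L)N x) = (2·√u₀)·gv`, `gv = g_{u₀}((1−σ_L)N x)^{σ_𝔮}`
          (`klein_charSum_log` / `pair_charSum_log`; `g = log/(2√u₀)`, row 101);
* `hor` — ORIENTATION of record `g = 2·√u₀` (`gaussX_eq_two_mul`);
* `hsq` — `g² = θ(−1)·2^e` (`gaussX_sq`, k3-g29);   `hθ` — `θ(−1)² = 1`.
Conclusion: `I = gv` — the measure value IS the `g`-value; the `2^{−e}` of `τ_dS` (B45) is absorbed by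
`g`'s denominator `2√u₀` EXACTLY, net `θ(−1)² = 1`.  [this file] -/
theorem seam_constant_one (e : ℕ) (θneg1 g gbar s S gv I : K) (h2 : (2 : K) ≠ 0)
    (hI : (2 : K) ^ e * I = gbar * S) (hbar : gbar = θneg1 * g) (hS : S = 2 * s * gv)
    (hor : g = 2 * s) (hsq : g ^ 2 = θneg1 * 2 ^ e) (hθ : θneg1 ^ 2 = 1) : I = gv := by
  have h1 : (2 : K) ^ e * I = (2 : K) ^ e * gv := by
    rw [hI, hbar, hS, ← hor]
    calc θneg1 * g * (g * gv) = (θneg1 * g ^ 2) * gv := by ring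
      _ = θneg1 ^ 2 * 2 ^ e * gv := by rw [hsq]; ring
      _ = 2 ^ e * gv := by rw [hθ, one_mul]
  exact mul_left_cancel₀ (pow_ne_zero _ h2) h1

/-- With the OPPOSITE orientation `g = −2·√u₀` the constant is the sign `θ(−1)`: `I = θ(−1)·gv`… stated as
`I = -gv` when moreover `θ(−1) = −1` (`χ₄`, `χ₈′`), `I = gv` when `θ(−1) = 1` (`χ₈`): either way a SIGN
(unit grade B44; invisible to `LowerDigit` and to every valuation). [this file] -/
theorem seam_constant_sign (e : ℕ) (θneg1 g gbar s S gv I : K) (h2 : (2 : K) ≠ 0)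
    (hI : (2 : K) ^ e * I = gbar * S) (hbar : gbar = θneg1 * g) (hS : S = 2 * s * gv)
    (hor : g = -(2 * s)) (hsq : g ^ 2 = θneg1 * 2 ^ e) (hθ : θneg1 ^ 2 = 1) : I = -gv := by
  have h1 : (2 : K) ^ e * I = (2 : K) ^ e * (-gv) := by
    have hs' : 2 * s = -g := by rw [hor, neg_neg]
    rw [hI, hbar, hS, hs']
    calc θneg1 * g * (-g * gv) = -((θneg1 * g ^ 2) * gv) := by ring
      _ = -(θneg1 ^ 2 * 2 ^ e * gv) := by rw [hsq]; ring
      _ = 2 ^ e * (-gv) := by rw [hθ, one_mul, mul_neg]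
  exact mul_left_cancel₀ (pow_ne_zero _ h2) h1

/-- **`e = 2` instance (`θ = χ₄`, keys `u ∈ {−1, 3}`, conductor 4):** all side conditions discharged by §2
(`ζ⁴ = −1` in `K`). [this file] -/
theorem seam_constant_one_condFour (ζ : K) (hζ : ζ ^ 4 = -1) (h2 : (2 : K) ≠ 0) (S gv I : K)
    (hI : (2 : K) ^ 2 * I = gauss4 (ζ ^ 7) * S) (hS : S = 2 * s4 ζ * gv) : I = gv :=
  seam_constant_one 2 (-1) (gauss4 ζ) (gauss4 (ζ ^ 7)) (s4 ζ) S gv I h2 hI (gauss4_inv ζ hζ) hS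
    (gauss4_eq_two_mul ζ hζ) (gauss4_sq ζ hζ) (by norm_num)

/-- **`e = 3`, `θ = χ₈` (keys `u ∈ {2, −6}`, conductor 8).** [this file] -/
theorem seam_constant_one_condEight (ζ : K) (hζ : ζ ^ 4 = -1) (h2 : (2 : K) ≠ 0) (S gv I : K)
    (hI : (2 : K) ^ 3 * I = gauss8 (ζ ^ 7) * S) (hS : S = 2 * s8 ζ * gv) : I = gv :=
  seam_constant_one 3 1 (gauss8 ζ) (gauss8 (ζ ^ 7)) (s8 ζ) S gv I h2 hI (gauss8_inv ζ hζ) hS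
    (gauss8_eq_two_mul ζ hζ) (gauss8_sq ζ hζ) (by norm_num)

/-- **`e = 3`, `θ = χ₈′` (keys `u ∈ {−2, 6}`, conductor 8).** [this file] -/
theorem seam_constant_one_condEight' (ζ : K) (hζ : ζ ^ 4 = -1) (h2 : (2 : K) ≠ 0) (S gv I : K)
    (hI : (2 : K) ^ 3 * I = gauss8' (ζ ^ 7) * S) (hS : S = 2 * s8' ζ * gv) : I = gv :=
  seam_constant_one 3 (-1) (gauss8' ζ) (gauss8' (ζ ^ 7)) (s8' ζ) S gv I h2 hI (gauss8'_inv ζ hζ) hS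
    (gauss8'_eq_two_mul ζ hζ) (gauss8'_sq ζ hζ) (by norm_num)

/-- **The 2-adic halves of R200′(c), now EXACT as an identity:** `τ_dS(θ̄) · r = 1` where
`τ_dS = 2^{−e}·ḡ` (II.4.8 (19)) and `r = 2√u₀` (the quadratic resolvent) — i.e. `ḡ · (2·s) = 2^e`:
`−n(key)/2` (τ_dS, docket (R2)) `+ n(key)/2` (`= 1 + v₂√u₀`, resolvent) `= 0` with NO residual unit
other than `θ(−1)² = 1`. [this file] -/
theorem tau_mul_resolvent (e : ℕ) (θneg1 g gbar s : K) (hbar : gbar = θneg1 * g) (hor : g = 2 * s)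
    (hsq : g ^ 2 = θneg1 * 2 ^ e) (hθ : θneg1 ^ 2 = 1) : gbar * (2 * s) = 2 ^ e := by
  rw [hbar, ← hor, mul_assoc, ← sq, hsq, ← mul_assoc, ← sq, hθ, one_mul]

/-- **`L`-currency (row 101: `L = Lg_u = (2w)•g`, `w` a unit of R206):** the measure value of one
`Gal(F/K)`-summand is `(2w)⁻¹ · L(…)`; so the consumer's `L`-values `4·unit | 2·unit` (conductor `4 | 8`,
`layerZero_condFour/Eight`) are measure values `2·unit | unit` — the factor `2w` is R206's, named here,
not netted. [this file] -/
theorem L_currency (w gv Lv I : K) (h2 : (2 : K) ≠ 0) (hw : w ≠ 0) (hL : Lv = 2 * w * gv)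
    (hI : I = gv) : I = (2 * w)⁻¹ * Lv := by
  rw [hI, hL, ← mul_assoc, inv_mul_cancel₀ (mul_ne_zero h2 hw), one_mul]

end Seam

/-! ## §4  The located wrinkle: `u` versus `u₀` (keys `u ∈ {3, 6, −6}`) -/

section Wrinkle

variable {K : Type*} [Field K]

/-- If `√u = ε·√u₀` with `ε` a unit (`ε² = u/u₀ ∈ {1, −3}`, a square in `F₁ = ℚ₂(ζ₃)` but NOT in `ℚ₂`
for `−3`), then `g_u = ε⁻¹·g_{u₀}`: the two `g`-currencies differ by a UNIT from layer `1` on; at layer `0`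
the `θ`-quadratic field `ℚ₂(√u₀)` and the route's `L₀(u) = ℚ₂(√u)` DIFFER for `u ∈ {3, 6, −6}` (located,
not resolved here: row 101 reads layer `0` on the route's own module). [this file] -/
theorem g_currency_rescale (logx su su0 ε : K) (hε : ε ≠ 0) (hsu0 : su0 ≠ 0) (h2 : (2 : K) ≠ 0)
    (h : su = ε * su0) : logx / (2 * su) = ε⁻¹ * (logx / (2 * su0)) := by
  rw [h]; field_simp

/-- `−3` is a square modulo `8`-adically relevant fact at layer 1: `(2ζ₃ + 1)² = −3` for a primitive cube
root of unity `ζ₃` (`ζ₃² + ζ₃ + 1 = 0`), so `√−3 ∈ F₁ = ℚ₂(ζ₃)`. [this file] -/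
theorem sqrt_neg_three_of_zeta3 {R : Type*} [CommRing R] (z : R) (hz : z ^ 2 + z + 1 = 0) :
    (2 * z + 1) ^ 2 = -3 := by
  linear_combination 4 * hz

end Wrinkle

end Summit.BirchSwinnertonDyer.BirchSwinnertonDyer.Cruxes.SplitBadTwoLowerHalfOfFacts.GaussIsResolventK2G37
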